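import Summits.RiemannHypothesis.RiemannHypothesis.Theorems.RuelleBandCofiniteCriticalLineStubDefinitizeAux
import HarnessLib

/-!
# Stub `stub_definitize` (line `cofinite-weil-index-staircase`, crux `RuelleBand.CofiniteCriticalLine`) —
auxiliary file 2: the derived test function `p(-D) f`, common windows, negative squares

Helpers for `Summits/RiemannHypothesis/RiemannHypothesis/Theorems/RuelleBandCofiniteCriticalLineStubDefinitize.lean`
(item stmt-RiemannHypothesis-2064, `--supports`), continuing `…StubDefinitizeAux.lean`
(normalisation of `Literature/NumberTheory/LFunctions/WeilExplicit.lean`; `B_g = WeilConverse.expSum g`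
is the translation kernel of the test function `g`: `Q(Σ_k c_k g(· - x_k)) = Σ c_k c̄_l B_g(x_k - x_l)`,
`stub_definitize_weilQuadratic_sum_translate`).

* `stub_definitize_expSum_derivPoly`: for `h = Σ_{j ≤ d} b_j (-1)^j f^{(j)}` (so that
  `ĥ(s) = p(s - 1/2) f̂(s)`, `p = Σ b_j X^j`, `stub_definitize_weilMellin_derivPoly`),
  `B_h = Σ_{j,m ≤ d} b_j conj(b_m) (-1)^m B_f^{(j+m)}`;
* `stub_definitize_weilQuadratic_orbit_derivPoly`: hence `Q` on the translation span of `h` is the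
  Toeplitz form of that derivative polynomial of `B_f`;
* `stub_definitize_exists_window`: all combinations `Σ_k c_k f(· - x_k)` live on one window;
* `stub_definitize_negSquares_le`: a uniform bound `N` on the window index of `Re Q` makes `B_f` a
  kernel with at most `N` negative squares (no `(N+1)`-dimensional negative-definite subspace of
  any Toeplitz form `Σ c_k c̄_l B_f(x_k - x_l)`);
* `stub_definitize_exists_twist`: the bookkeeping `p(X) = P(-iX)` between the polynomial of the
  definitization theorem and the polynomial of the stub.
-/

set_option linter.dupNamespace false

noncomputable section

open Complex MeasureTheory Filter Set
open scoped BigOperators Topology ComplexConjugate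

namespace Summit.RiemannHypothesis.RiemannHypothesis.Theorems.RuelleBandCofiniteCriticalLine

open Literature.NumberTheory.LFunctions

/-! ### The derived test function `h = Σ_j b_j (-1)^j f^{(j)}` ("`p(-D) f`") -/

/-- `h = Σ_{j ≤ d} b_j (-1)^j f^{(j)}` is a test function. [folklore] -/
theorem stub_definitize_isWeilTest_derivPoly {f : ℝ → ℂ} (hf : IsWeilTest f) (d : ℕ) (b : ℕ → ℂ) :
    IsWeilTest (fun t => ∑ j ∈ Finset.range (d + 1), b j * (-1 : ℂ) ^ j * iteratedDeriv j f t) :=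
  stub_definitize_isWeilTest_finset_sum (g := fun j => iteratedDeriv j f) _
    (fun j => b j * (-1 : ℂ) ^ j) fun j _ => stub_definitize_isWeilTest_iteratedDeriv hf j

/-- **Transform of `p(-D) f`**: `ĥ(s) = (Σ_j b_j (s - 1/2)^j) f̂(s) = p(s - 1/2) f̂(s)` for
`h = Σ_j b_j (-1)^j f^{(j)}` (`(f^{(j)})^ = (-(s-1/2))^j f̂`). [folklore] -/
theorem stub_definitize_weilMellin_derivPoly {f : ℝ → ℂ} (hf : IsWeilTest f) (d : ℕ) (b : ℕ → ℂ)
    (z : ℂ) :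
    weilMellin (fun t => ∑ j ∈ Finset.range (d + 1), b j * (-1 : ℂ) ^ j * iteratedDeriv j f t) z =
      (∑ j ∈ Finset.range (d + 1), b j * (z - 1 / 2) ^ j) * weilMellin f z := by
  rw [stub_definitize_weilMellin_finset_sum (g := fun j => iteratedDeriv j f) _
    (fun j => b j * (-1 : ℂ) ^ j) (fun j _ => stub_definitize_isWeilTest_iteratedDeriv hf j),
    Finset.sum_mul]
  refine Finset.sum_congr rfl fun j _ => ?_
  have e : ((-1 : ℂ)) ^ j * (-(z - 1 / 2)) ^ j = (z - 1 / 2) ^ j := by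
    rw [← mul_pow, neg_one_mul, neg_neg]
  rw [stub_definitize_weilMellin_iteratedDeriv hf z j, ← e]
  ring

/-- **Pair coefficient of `p(-D) f`**:
`P_h(ρ) = (Σ_{j,m} b_j conj(b_m) (-1)^m (ρ-1/2)^{j+m}) P_f(ρ)`, i.e.
`P_h(ρ) = p(ρ - 1/2) · conj(p(1/2 - ρ̄)) · P_f(ρ)` with `p = Σ b_j X^j`, the product expanded.
[folklore] -/
theorem stub_definitize_pairCoeff_derivPoly {f : ℝ → ℂ} (hf : IsWeilTest f) (d : ℕ) (b : ℕ → ℂ)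
    (ρ : ℂ) :
    WeilConverse.pairCoeff
        (fun t => ∑ j ∈ Finset.range (d + 1), b j * (-1 : ℂ) ^ j * iteratedDeriv j f t) ρ =
      (∑ j ∈ Finset.range (d + 1), ∑ m ∈ Finset.range (d + 1),
          b j * conj (b m) * (-1 : ℂ) ^ m * (ρ - 1 / 2) ^ (j + m)) *
        WeilConverse.pairCoeff f ρ := by
  have hc : conj (1 - conj ρ - 1 / 2) = -(ρ - 1 / 2) := by
    simp only [map_sub, map_one, Complex.conj_conj, map_div₀, map_ofNat]
    ring
  have hB : conj (∑ m ∈ Finset.range (d + 1), b m * (1 - conj ρ - 1 / 2) ^ m) =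
      ∑ m ∈ Finset.range (d + 1), conj (b m) * (-1 : ℂ) ^ m * (ρ - 1 / 2) ^ m := by
    rw [map_sum]
    refine Finset.sum_congr rfl fun m _ => ?_
    rw [map_mul, map_pow, hc, neg_pow]
    ring
  have hS : (∑ j ∈ Finset.range (d + 1), b j * (ρ - 1 / 2) ^ j) *
      (∑ m ∈ Finset.range (d + 1), conj (b m) * (-1 : ℂ) ^ m * (ρ - 1 / 2) ^ m) =
      ∑ j ∈ Finset.range (d + 1), ∑ m ∈ Finset.range (d + 1),
        b j * conj (b m) * (-1 : ℂ) ^ m * (ρ - 1 / 2) ^ (j + m) := by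
    rw [Finset.sum_mul_sum]
    refine Finset.sum_congr rfl fun j _ => Finset.sum_congr rfl fun m _ => ?_
    rw [pow_add]
    ring
  rw [WeilConverse.pairCoeff, WeilConverse.pairCoeff, stub_definitize_weilMellin_derivPoly hf,
    stub_definitize_weilMellin_derivPoly hf, map_mul, hB, ← hS]
  ring

/-- **The kernel of `p(-D) f` is a derivative polynomial of the kernel of `f`**:
`B_h(x) = Σ_{j,m ≤ d} b_j conj(b_m) (-1)^m B_f^{(j+m)}(x)` for `h = Σ_{j ≤ d} b_j (-1)^j f^{(j)}`
(termwise: `P_h(ρ) e^{(ρ-1/2)x} = Σ_{j,m} b_j b̄_m (-1)^m · P_f(ρ)(ρ-1/2)^{j+m} e^{(ρ-1/2)x}` and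
`stub_definitize_iteratedDeriv_expSum`). [folklore] -/
theorem stub_definitize_expSum_derivPoly {f : ℝ → ℂ} (hf : IsWeilTest f) (d : ℕ) (b : ℕ → ℂ)
    (x : ℝ) :
    WeilConverse.expSum
        (fun t => ∑ j ∈ Finset.range (d + 1), b j * (-1 : ℂ) ^ j * iteratedDeriv j f t) x =
      ∑ j ∈ Finset.range (d + 1), ∑ m ∈ Finset.range (d + 1),
        b j * conj (b m) * (-1 : ℂ) ^ m * iteratedDeriv (j + m) (WeilConverse.expSum f) x := by
  simp_rw [stub_definitize_iteratedDeriv_expSum hf]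
  rw [WeilConverse.expSum]
  simp_rw [stub_definitize_pairCoeff_derivPoly hf]
  have hS := fun r : ℕ => stub_definitize_summable_term hf r x
  calc ∑' ρ : ZetaZeros.riemannZetaNontrivialZeros, (riemannZetaZeroOrder (ρ : ℂ) : ℂ) *
        ((∑ j ∈ Finset.range (d + 1), ∑ m ∈ Finset.range (d + 1),
          b j * conj (b m) * (-1 : ℂ) ^ m * ((ρ : ℂ) - 1 / 2) ^ (j + m)) *
            WeilConverse.pairCoeff f ρ) * cexp (((ρ : ℂ) - 1 / 2) * x)
      = ∑' ρ : ZetaZeros.riemannZetaNontrivialZeros, ∑ j ∈ Finset.range (d + 1),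
          ∑ m ∈ Finset.range (d + 1), b j * conj (b m) * (-1 : ℂ) ^ m *
            ((riemannZetaZeroOrder (ρ : ℂ) : ℂ) * WeilConverse.pairCoeff f ρ *
              ((ρ : ℂ) - 1 / 2) ^ (j + m) * cexp (((ρ : ℂ) - 1 / 2) * x)) := by
        refine tsum_congr fun ρ => ?_
        rw [Finset.sum_mul, Finset.mul_sum, Finset.sum_mul]
        refine Finset.sum_congr rfl fun j _ => ?_
        rw [Finset.sum_mul, Finset.mul_sum, Finset.sum_mul]
        refine Finset.sum_congr rfl fun m _ => ?_
        ring
    _ = ∑ j ∈ Finset.range (d + 1), ∑' ρ : ZetaZeros.riemannZetaNontrivialZeros,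
          ∑ m ∈ Finset.range (d + 1), b j * conj (b m) * (-1 : ℂ) ^ m *
            ((riemannZetaZeroOrder (ρ : ℂ) : ℂ) * WeilConverse.pairCoeff f ρ *
              ((ρ : ℂ) - 1 / 2) ^ (j + m) * cexp (((ρ : ℂ) - 1 / 2) * x)) :=
        Summable.tsum_finsetSum fun j _ => summable_sum fun m _ => (hS (j + m)).mul_left _
    _ = ∑ j ∈ Finset.range (d + 1), ∑ m ∈ Finset.range (d + 1),
          ∑' ρ : ZetaZeros.riemannZetaNontrivialZeros, b j * conj (b m) * (-1 : ℂ) ^ m *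
            ((riemannZetaZeroOrder (ρ : ℂ) : ℂ) * WeilConverse.pairCoeff f ρ *
              ((ρ : ℂ) - 1 / 2) ^ (j + m) * cexp (((ρ : ℂ) - 1 / 2) * x)) :=
        Finset.sum_congr rfl fun j _ => Summable.tsum_finsetSum fun m _ => (hS (j + m)).mul_left _
    _ = ∑ j ∈ Finset.range (d + 1), ∑ m ∈ Finset.range (d + 1), b j * conj (b m) * (-1 : ℂ) ^ m *
          ∑' ρ : ZetaZeros.riemannZetaNontrivialZeros,
            (riemannZetaZeroOrder (ρ : ℂ) : ℂ) * WeilConverse.pairCoeff f ρ *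
              ((ρ : ℂ) - 1 / 2) ^ (j + m) * cexp (((ρ : ℂ) - 1 / 2) * x) := by
        simp_rw [tsum_mul_left]

/-- **`Q` on the translation span of `p(-D) f`**: for a test function `f`, coefficients `b_j`
(`j ≤ d`), points `x_k` and coefficients `c_k`,
`Q(Σ_k c_k h(· - x_k)) = Σ_{k,l} c_k c̄_l Σ_{j,m ≤ d} b_j b̄_m (-1)^m B_f^{(j+m)}(x_k - x_l)` where
`h = Σ_{j ≤ d} b_j (-1)^j f^{(j)}` and `B_f = WeilConverse.expSum f`. [folklore] -/
theorem stub_definitize_weilQuadratic_orbit_derivPoly {f : ℝ → ℂ} (hf : IsWeilTest f) (d : ℕ)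
    (b : ℕ → ℂ) {n : ℕ} (x : Fin n → ℝ) (c : Fin n → ℂ) :
    weilQuadratic (fun t => ∑ k, c k *
        ∑ j ∈ Finset.range (d + 1), b j * (-1 : ℂ) ^ j * iteratedDeriv j f (t - x k)) =
      ∑ k, ∑ l, c k * conj (c l) *
        ∑ j ∈ Finset.range (d + 1), ∑ m ∈ Finset.range (d + 1),
          b j * conj (b m) * (-1 : ℂ) ^ m *
            iteratedDeriv (j + m) (WeilConverse.expSum f) (x k - x l) := by
  have h := stub_definitize_weilQuadratic_sum_translate
    (g := fun u => ∑ j ∈ Finset.range (d + 1), b j * (-1 : ℂ) ^ j * iteratedDeriv j f u)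
    (stub_definitize_isWeilTest_derivPoly hf d b) x c
  simp_rw [stub_definitize_expSum_derivPoly hf] at h
  exact h

/-! ### One window for all combinations of finitely many translates -/

/-- Finitely many translates of a test function live on a common window: there is `a` with
`tsupport (Σ_k c_k f(· - x_k)) ⊆ [-a, a]` for every choice of the coefficients `c`. [folklore] -/
theorem stub_definitize_exists_window {f : ℝ → ℂ} (hf : IsWeilTest f) {n : ℕ} (x : Fin n → ℝ) :
    ∃ a : ℝ, ∀ c : Fin n → ℂ, tsupport (fun t => ∑ k, c k * f (t - x k)) ⊆ Set.Icc (-a) a := by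
  obtain ⟨R, hR⟩ := hf.2.isCompact.isBounded.subset_closedBall 0
  refine ⟨R + ∑ k, |x k|, fun c => ?_⟩
  refine closure_minimal (fun t ht => ?_) isClosed_Icc
  obtain ⟨k, -, hk⟩ := Finset.exists_ne_zero_of_sum_ne_zero ht
  have hmem : t - x k ∈ Metric.closedBall (0 : ℝ) R :=
    hR (subset_tsupport _ (right_ne_zero_of_mul hk))
  rw [Metric.mem_closedBall, dist_zero_right, Real.norm_eq_abs] at hmem
  have hxk : |x k| ≤ ∑ l, |x l| :=
    Finset.single_le_sum (f := fun l => |x l|) (fun l _ => abs_nonneg _) (Finset.mem_univ k)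
  have h1 : |t| ≤ |t - x k| + |x k| := by
    have := abs_add_le (t - x k) (x k)
    rwa [sub_add_cancel] at this
  constructor <;> [linarith [neg_abs_le t]; linarith [le_abs_self t]]

/-! ### From a uniform window-index bound to "at most `N` negative squares" -/

/-- **The translation kernel has at most `N` negative squares.** If on every window `[-a, a]`
every `(N+1)`-tuple of test functions admits a non-trivial combination with `Re Q ≥ 0`, then for
every test function `f`, all `n`, points `x : Fin n → ℝ` and any `N + 1` coefficient vectors
`v_0, …, v_N ∈ ℂⁿ`, some non-trivial combination `d = Σ_i w_i v_i` has
`Re Σ_{k,l} d_k d̄_l B_f(x_k - x_l) ≥ 0` (apply the hypothesis to the `N + 1` test functions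
`Σ_k v_{ik} f(· - x_k)`, which live on one window, and use the orbit formula). [folklore] -/
theorem stub_definitize_negSquares_le {N : ℕ}
    (hN : ∀ a : ℝ, ∀ g : Fin (N + 1) → ℝ → ℂ, (∀ i, IsWeilTest (g i)) →
        (∀ i, tsupport (g i) ⊆ Set.Icc (-a) a) →
        ∃ c : Fin (N + 1) → ℂ, c ≠ 0 ∧ 0 ≤ (weilQuadratic (fun t => ∑ i, c i * g i t)).re)
    {f : ℝ → ℂ} (hf : IsWeilTest f) (n : ℕ) (x : Fin n → ℝ) (v : Fin (N + 1) → Fin n → ℂ) :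
    ∃ w : Fin (N + 1) → ℂ, w ≠ 0 ∧
      0 ≤ (∑ k, ∑ l, (∑ i, w i * v i k) * conj (∑ i, w i * v i l) *
        WeilConverse.expSum f (x k - x l)).re := by
  obtain ⟨a, ha⟩ := stub_definitize_exists_window hf x
  obtain ⟨c, hc0, hc⟩ := hN a (fun i t => ∑ k, v i k * f (t - x k))
    (fun i => stub_definitize_isWeilTest_finset_sum (g := fun k t => f (t - x k)) _ _
      fun k _ => hf.weilTranslate (x k))
    (fun i => ha (v i))
  refine ⟨c, hc0, ?_⟩
  have e : (fun t => ∑ i, c i * ∑ k, v i k * f (t - x k)) =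
      fun t => ∑ k, (∑ i, c i * v i k) * f (t - x k) := by
    funext t
    simp_rw [Finset.mul_sum, Finset.sum_mul]
    rw [Finset.sum_comm]
    refine Finset.sum_congr rfl fun k _ => Finset.sum_congr rfl fun i _ => ?_
    ring
  rwa [e, stub_definitize_weilQuadratic_sum_translate hf] at hc

/-! ### Bookkeeping: the twisted polynomial `p(X) = P(-iX)` -/

/-- For a non-zero polynomial `P` there is a non-zero `p` of the same degree with coefficients
`p_j = P_j (-i)^j` (namely `p(X) = P(-iX)`). [folklore] -/
theorem stub_definitize_exists_twist {P : Polynomial ℂ} (hP : P ≠ 0) :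
    ∃ p : Polynomial ℂ, p ≠ 0 ∧ p.natDegree = P.natDegree ∧
      ∀ j, p.coeff j = P.coeff j * (-I) ^ j := by
  set p : Polynomial ℂ := ∑ j ∈ Finset.range (P.natDegree + 1),
    Polynomial.monomial j (P.coeff j * (-I) ^ j) with hp
  have hcoeff : ∀ j, p.coeff j = P.coeff j * (-I) ^ j := by
    intro j
    rw [hp, Polynomial.finsetSum_coeff]
    simp only [Polynomial.coeff_monomial, Finset.sum_ite_eq', Finset.mem_range]
    split_ifs with h
    · rfl
    · rw [Polynomial.coeff_eq_zero_of_natDegree_lt (by omega), zero_mul]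
  have hlead : p.coeff P.natDegree ≠ 0 := by
    rw [hcoeff]
    exact mul_ne_zero (Polynomial.leadingCoeff_ne_zero.2 hP) (pow_ne_zero _ (neg_ne_zero.2 I_ne_zero))
  have hp0 : p ≠ 0 := fun h => hlead (by rw [h, Polynomial.coeff_zero])
  refine ⟨p, hp0, le_antisymm ?_ (Polynomial.le_natDegree_of_ne_zero hlead), hcoeff⟩
  rw [Polynomial.natDegree_le_iff_coeff_eq_zero]
  intro j hj
  rw [hcoeff, Polynomial.coeff_eq_zero_of_natDegree_lt hj, zero_mul]

/-- The coefficient identity behind `p(X) = P(-iX)`: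
`p_j conj(p_m) (-1)^m = P_j conj(P_m) (-i)^{j+m}` for `p_j = P_j (-i)^j`. [folklore] -/
theorem stub_definitize_twist_coeff (Pj Pm : ℂ) (j m : ℕ) :
    Pj * (-I) ^ j * conj (Pm * (-I) ^ m) * (-1 : ℂ) ^ m = Pj * conj Pm * (-I) ^ (j + m) := by
  rw [map_mul, map_pow, map_neg, Complex.conj_I, neg_neg, pow_add]
  have : I ^ m * (-1 : ℂ) ^ m = (-I) ^ m := by rw [← mul_pow, mul_neg_one]
  rw [← this]
  ring

/-! ### Landing anchor -/

/-- **Landing anchor of this auxiliary file** (registered sub-goal `stub_definitize_aux2` of item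
stmt-RiemannHypothesis-2064, stub `stub_definitize`): a uniform window-index bound `N` makes the
translation kernel `B_f` of every test function a kernel with at most `N` negative squares;
binder-free restatement of `stub_definitize_negSquares_le`. [folklore] -/
theorem stub_definitize_aux2 : ∀ {N : ℕ}, (∀ a : ℝ, ∀ g : Fin (N + 1) → ℝ → ℂ,
    (∀ i, IsWeilTest (g i)) → (∀ i, tsupport (g i) ⊆ Set.Icc (-a) a) →
      ∃ c : Fin (N + 1) → ℂ, c ≠ 0 ∧ 0 ≤ (weilQuadratic (fun t => ∑ i, c i * g i t)).re) →
    ∀ {f : ℝ → ℂ}, IsWeilTest f → ∀ (n : ℕ) (x : Fin n → ℝ) (v : Fin (N + 1) → Fin n → ℂ),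
      ∃ w : Fin (N + 1) → ℂ, w ≠ 0 ∧
        0 ≤ (∑ k, ∑ l, (∑ i, w i * v i k) * conj (∑ i, w i * v i l) *
          WeilConverse.expSum f (x k - x l)).re :=
  fun hN _ hf n x v => stub_definitize_negSquares_le hN hf n x v

end Summit.RiemannHypothesis.RiemannHypothesis.Theorems.RuelleBandCofiniteCriticalLine

end
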